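import Literature.AlgebraicGeometry.Resolution.FormalBranchesModel
import Mathlib.RingTheory.Localization.BaseChange
import Mathlib.RingTheory.TensorProduct.Quotient
import Mathlib.RingTheory.Flat.Basic
import HarnessLib

/-!
# The chart of the double locus commutes with flat base change; its formal branch decomposition

Topic: `Literature/AlgebraicGeometry/Resolution`. Second file of the Artin-approximation-free
proof that FORMAL normal crossings are étale-local normal crossings (de Jong 1996, between
4.25 (i) and 4.28/2.4; the named fact `DeJong1996FormalNormalCrossings` of
`AlterationsNormalFormBlowup.lean`), after `FormalBranchesModel.lean`, whose MAIN RESULT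
`branchModelEquiv` computes, inside a regular local ring `P` with independent `x₁, …, x_d`, the
generic chart of the blow-up of `Spec P/(x₁ ⋯ x_r)` along the double locus `(m_j)_{j<r}`:
`(P/(π))[(m_j)_j / s] ≅ Π_{j<r} P/(xⱼ)` for `s = Σ a_j m_j` with unit coefficients. Everything
here is PROVED; no named facts.

The point of that computation is that affine blowup algebras are defined by polynomial data
(an ideal and one element) and commute with FLAT base change (Stacks, Tag 0805), so the chart
can be formed over the algebraic local ring `A` of the variety and compared with the formal
model over `P = Â`:

* `chartBaseChangeEquiv` — **affine blowup algebras commute with flat base change, with a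
  quotient built in**: for a ring map `A → Ah` with `Ah` flat over `A`, ideals `I ⊆ A`,
  `K = I·Ah`, `J ⊆ A/I` and `t ∈ A/I` with image `sb ∈ Ah/K`,
  `Ah ⊗_A (A/I)[J/t] ≅ (Ah/K)[J·(Ah/K) / sb]` as `Ah`-algebras (the affine blowup algebra
  `blowupAlgebra` of `AffineBlowupAlgebra.lean`, image model inside the localisation). Proof:
  the comparison map `Θ : y ⊗ c ↦ ȳ·ψ(c)` (`chartMap`; `ψ : (A/I)[1/t] → (Ah/K)[1/sb]`) is the
  restriction of the ISOMORPHISM `Θ̃ : Ah ⊗_A (A/I)[1/t] ≅ (Ah/K)[1/sb]` (`locChartMap`; it is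
  Mathlib's `Ah ⊗_A (A/I)[1/t] ≅ (Ah ⊗_A A/I)[1/(1 ⊗ t)]`,
  `IsLocalization.Away.tensorProductEquivTMulRight`, followed by the localisation of
  `Ah ⊗_A A/I ≅ Ah/K`), along `Ah ⊗ incl`, injective by flatness (`chartMap_injective`); its range
  is the blowup algebra downstairs (`range_chartMap`: the generators `w/sb`,
  `w = Σ β_k q(x_k) ∈ J·(Ah/K)`, are `Σ β_k Θ(1 ⊗ x_k/t)`).
* `doubleLocusChart I 𝔇 s = (A/I)[𝔇̄/s̄]` — the chart of the double locus, and
  `doubleLocusChartEquiv` — **its formal branch decomposition**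
  `P ⊗_A (A/I)[𝔇̄/s̄] ≅ Π_{j<r} P/(xⱼ)` (over `P`) whenever `A → P` is flat, `I·P = (x₁ ⋯ x_r)`,
  `𝔇·P ≡ (m_j)_{j<r}` and `s ≡ Σ_j a_j m_j` (`a_j` units) modulo `(x₁ ⋯ x_r)`
  (`chartBaseChangeEquiv` + `branchModelEquiv`); `finite_doubleLocusChart` — hence the chart is
  a FINITE `A`-algebra when `A → P` is faithfully flat (descent of finiteness, Mathlib
  `Module.Finite.of_finite_tensorProduct_of_faithfullyFlat`).

These are the inputs `C`, `Φ` of `exists_etale_isSNCIdeal_of_branchDecomposition`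
(`FormalBranchesSplitting.lean`); the ideal `𝔇` and the element `s` are produced from the
partial derivatives of the equation of the divisor in `FormalBranchesJacobian.lean`.

## Sources

* A. J. de Jong, *Smoothness, semi-stability and alterations*, Publ. Math. IHÉS 83 (1996),
  4.25 (i), p. 75 (the formal normal crossings condition served). [DeJong1996]
* The Stacks Project, Tag 052Q (affine blowup algebras), Tag 0805 (blowing up commutes with
  flat base change). [StacksProject]
-/

noncomputable section

open IsLocalRing TensorProduct

namespace Literature.AlgebraicGeometry.Resolution

universe u

section BaseChange

variable {A : Type u} [CommRing A] (I : Ideal A) {Ah : Type u} [CommRing Ah] [Algebra A Ah]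
variable (K : Ideal Ah) (hK : I.map (algebraMap A Ah) = K)

include hK in
/-- `I ⊆ A` maps into `K = I·Ah`. [folklore] -/
theorem le_comap_of_map_eq : I ≤ K.comap (algebraMap A Ah) := by
  rw [← hK]
  exact Ideal.le_comap_map

/-- The map `q : A/I → Ah/K` (`K = I Ah`). [folklore] -/
def quotBaseChange : A ⧸ I →+* Ah ⧸ K :=
  Ideal.quotientMap K (algebraMap A Ah) (le_comap_of_map_eq I K hK)

/-- `q ā = \\overline{ι a}`. [folklore] -/
theorem quotBaseChange_mk (a : A) :
    quotBaseChange I K hK (Ideal.Quotient.mk I a) = Ideal.Quotient.mk K (algebraMap A Ah a) :=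
  Ideal.quotientMap_mk

/-- `q` is compatible with the structure maps from `A`. [folklore] -/
theorem quotBaseChange_comp_algebraMap :
    (quotBaseChange I K hK).comp (algebraMap A (A ⧸ I)) = algebraMap A (Ah ⧸ K) := by
  ext a
  rw [RingHom.comp_apply, Ideal.Quotient.algebraMap_eq, quotBaseChange_mk,
    IsScalarTower.algebraMap_apply A Ah (Ah ⧸ K), Ideal.Quotient.algebraMap_eq]

/-- **`Ah ⊗_A A/I ≅ Ah/K`** for `K = I Ah`. [folklore] -/
def tensorQuotEquiv : Ah ⊗[A] (A ⧸ I) ≃ₐ[Ah] Ah ⧸ K :=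
  (Algebra.TensorProduct.quotIdealMapEquivTensorQuot Ah I).symm.trans
    (Ideal.quotientEquivAlgOfEq Ah hK)

/-- `ε (y ⊗ ā) = \\overline{ι(a) y}`. [folklore] -/
theorem tensorQuotEquiv_tmul (y : Ah) (a : A) :
    tensorQuotEquiv I K hK (y ⊗ₜ Ideal.Quotient.mk I a) =
      Ideal.Quotient.mk K (algebraMap A Ah a * y) := by
  rw [tensorQuotEquiv, AlgEquiv.trans_apply]
  have h1 : (Algebra.TensorProduct.quotIdealMapEquivTensorQuot Ah I).symm
      (y ⊗ₜ[A] Ideal.Quotient.mk I a) = Ideal.Quotient.mk _ (algebraMap A Ah a * y) := by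
    rw [← Algebra.smul_def]
    exact Algebra.TensorProduct.quotIdealMapEquivTensorQuot_symm_tmul (B := Ah) (I := I) y a
  rw [h1]
  rfl

/-- In particular `ε (1 ⊗ b) = q b`. [folklore] -/
theorem tensorQuotEquiv_one_tmul (b : A ⧸ I) :
    tensorQuotEquiv I K hK (1 ⊗ₜ b) = quotBaseChange I K hK b := by
  obtain ⟨a, rfl⟩ := Ideal.Quotient.mk_surjective b
  rw [tensorQuotEquiv_tmul, mul_one, quotBaseChange_mk]

/-- And `ε (y ⊗ 1) = ȳ`. [folklore] -/
theorem tensorQuotEquiv_tmul_one (y : Ah) :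
    tensorQuotEquiv I K hK (y ⊗ₜ 1) = Ideal.Quotient.mk K y := by
  rw [← map_one (Ideal.Quotient.mk I), tensorQuotEquiv_tmul, map_one, one_mul]

variable (J : Ideal (A ⧸ I)) (t : A ⧸ I) (sb : Ah ⧸ K) (hsb : quotBaseChange I K hK t = sb)

include hsb in
/-- Powers of `t` map to powers of `sb = q t`. [folklore] -/
theorem powers_le_comap_powers :
    Submonoid.powers t ≤ (Submonoid.powers sb).comap (quotBaseChange I K hK) := by
  rintro _ ⟨n, rfl⟩
  exact ⟨n, by rw [map_pow, hsb]⟩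

/-- `ψ : (A/I)[1/t] → (Ah/K)[1/sb]` induced by `q`. [folklore] -/
def locMap : Localization.Away t →+* Localization.Away sb :=
  IsLocalization.map (Localization.Away sb) (quotBaseChange I K hK)
    (powers_le_comap_powers I K hK t sb hsb)

/-- `ψ` on elements of `A/I`. [folklore] -/
theorem locMap_algebraMap (b : A ⧸ I) :
    locMap I K hK t sb hsb (algebraMap (A ⧸ I) (Localization.Away t) b) =
      algebraMap (Ah ⧸ K) (Localization.Away sb) (quotBaseChange I K hK b) :=
  IsLocalization.map_eq _ b

/-- `ψ (1/t) = 1/sb`. [folklore] -/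
theorem locMap_invSelf :
    locMap I K hK t sb hsb (IsLocalization.Away.invSelf t) = IsLocalization.Away.invSelf sb := by
  rw [IsLocalization.Away.invSelf, IsLocalization.Away.invSelf, locMap, IsLocalization.map_mk',
    map_one]
  congr 1
  exact Subtype.ext hsb

/-- `ψ` as an `A`-algebra map. [folklore] -/
def locMapₐ : Localization.Away t →ₐ[A] Localization.Away sb where
  toRingHom := locMap I K hK t sb hsb
  commutes' a := by
    change locMap I K hK t sb hsb (algebraMap A (Localization.Away t) a) =
      algebraMap A (Localization.Away sb) a
    rw [IsScalarTower.algebraMap_apply A (A ⧸ I) (Localization.Away t), locMap_algebraMap,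
      IsScalarTower.algebraMap_apply A (Ah ⧸ K) (Localization.Away sb), ← RingHom.comp_apply
        (quotBaseChange I K hK) (algebraMap A (A ⧸ I)), quotBaseChange_comp_algebraMap]

/-- **The comparison map `Θ : Ah ⊗_A (A/I)[J/t] → (Ah/K)[1/sb]`**, `y ⊗ c ↦ ȳ · ψ(c)`. [folklore] -/
def chartMap : Ah ⊗[A] ↥(blowupAlgebra J t) →ₐ[Ah] Localization.Away sb :=
  Algebra.TensorProduct.lift (Algebra.ofId Ah (Localization.Away sb))
    ((locMapₐ I K hK t sb hsb).comp ((blowupAlgebra J t).val.restrictScalars A))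
    fun _ _ => Commute.all _ _

/-- `Θ (y ⊗ c) = ȳ · ψ(c)`. [folklore] -/
theorem chartMap_tmul (y : Ah) (c : ↥(blowupAlgebra J t)) :
    chartMap I K hK J t sb hsb (y ⊗ₜ c) =
      algebraMap Ah (Localization.Away sb) y * locMap I K hK t sb hsb (c : Localization.Away t) :=
  Algebra.TensorProduct.lift_tmul _ _ _ y c


/-! ### Injectivity: `Θ` extends to the isomorphism `Ah ⊗_A (A/I)[1/t] ≅ (Ah/K)[1/sb]` -/

/-- `Θ̃ : Ah ⊗_A (A/I)[1/t] → (Ah/K)[1/sb]`, `y ⊗ z ↦ ȳ · ψ(z)`. [folklore] -/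
def locChartMap : Ah ⊗[A] Localization.Away t →ₐ[Ah] Localization.Away sb :=
  Algebra.TensorProduct.lift (Algebra.ofId Ah (Localization.Away sb)) (locMapₐ I K hK t sb hsb)
    fun _ _ => Commute.all _ _

/-- `Θ̃ (y ⊗ z) = ȳ · ψ(z)`. [folklore] -/
theorem locChartMap_tmul (y : Ah) (z : Localization.Away t) :
    locChartMap I K hK t sb hsb (y ⊗ₜ z) =
      algebraMap Ah (Localization.Away sb) y * locMap I K hK t sb hsb z :=
  Algebra.TensorProduct.lift_tmul _ _ _ y z

/-- `Θ = Θ̃ ∘ (Ah ⊗ incl)`. [folklore] -/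
theorem chartMap_eq_locChartMap_map (z : Ah ⊗[A] ↥(blowupAlgebra J t)) :
    chartMap I K hK J t sb hsb z = locChartMap I K hK t sb hsb
      (Algebra.TensorProduct.map (AlgHom.id Ah Ah) ((blowupAlgebra J t).val.restrictScalars A) z) := by
  induction z using TensorProduct.induction_on with
  | zero => rw [map_zero, map_zero, map_zero]
  | tmul y c =>
    rw [chartMap_tmul, Algebra.TensorProduct.map_tmul, locChartMap_tmul, AlgHom.id_apply]
    rfl
  | add z₁ z₂ h₁ h₂ => rw [map_add, h₁, h₂, map_add, map_add]

include hsb in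
/-- The powers of `1 ⊗ t ∈ Ah ⊗_A A/I` correspond to the powers of `sb` under `ε`. [folklore] -/
theorem map_powers_one_tmul :
    (Submonoid.powers ((1 : Ah) ⊗ₜ[A] t)).map (tensorQuotEquiv I K hK).toRingEquiv.toMonoidHom =
      Submonoid.powers sb := by
  rw [Submonoid.map_powers]
  congr 1
  change tensorQuotEquiv I K hK ((1 : Ah) ⊗ₜ[A] t) = sb
  rw [tensorQuotEquiv_one_tmul, hsb]

/-- **`(Ah ⊗_A A/I)[1/(1 ⊗ t)] ≅ (Ah/K)[1/sb]`** along `ε : Ah ⊗_A A/I ≅ Ah/K`. [folklore] -/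
def locTensorQuotEquiv : Localization.Away ((1 : Ah) ⊗ₜ[A] t) ≃+* Localization.Away sb :=
  IsLocalization.ringEquivOfRingEquiv (M := Submonoid.powers ((1 : Ah) ⊗ₜ[A] t))
    (T := Submonoid.powers sb) (Localization.Away ((1 : Ah) ⊗ₜ[A] t)) (Localization.Away sb)
    (tensorQuotEquiv I K hK).toRingEquiv (map_powers_one_tmul I K hK t sb hsb)

/-- `Θ̃` is the composite of Mathlib's `Ah ⊗_A (A/I)[1/t] ≅ (Ah ⊗_A A/I)[1/(1 ⊗ t)]` with
`(Ah ⊗_A A/I)[1/(1 ⊗ t)] ≅ (Ah/K)[1/sb]`; in particular it is bijective. [folklore] -/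
theorem locChartMap_eq (z : Ah ⊗[A] Localization.Away t) :
    locChartMap I K hK t sb hsb z = locTensorQuotEquiv I K hK t sb hsb
      (IsLocalization.Away.tensorProductEquivTMulRight A Ah t (Localization.Away t) z) := by
  -- both sides are ring homomorphisms; compare on `y ⊗ 1` and on `1 ⊗ z`
  induction z using TensorProduct.induction_on with
  | zero => rw [map_zero, map_zero, map_zero]
  | tmul y z =>
    have hy : locChartMap I K hK t sb hsb (y ⊗ₜ 1) = locTensorQuotEquiv I K hK t sb hsb
        (IsLocalization.Away.tensorProductEquivTMulRight A Ah t (Localization.Away t) (y ⊗ₜ 1)) := by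
      rw [locChartMap_tmul, map_one, mul_one, ← map_one (algebraMap (A ⧸ I) (Localization.Away t)),
        IsLocalization.Away.tensorProductEquivTMulRight_tmul, locTensorQuotEquiv,
        IsLocalization.ringEquivOfRingEquiv_eq]
      change _ = algebraMap (Ah ⧸ K) (Localization.Away sb) (tensorQuotEquiv I K hK (y ⊗ₜ[A] 1))
      rw [tensorQuotEquiv_tmul_one, ← Ideal.Quotient.algebraMap_eq, ← IsScalarTower.algebraMap_apply]
    have hz : ∀ z : Localization.Away t, locChartMap I K hK t sb hsb (1 ⊗ₜ z) =
        locTensorQuotEquiv I K hK t sb hsb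
          (IsLocalization.Away.tensorProductEquivTMulRight A Ah t (Localization.Away t) (1 ⊗ₜ z)) := by
      intro z
      -- two ring maps `(A/I)[1/t] → (Ah/K)[1/sb]` agreeing on `A/I`
      let f₁ : Localization.Away t →+* Localization.Away sb :=
        (locChartMap I K hK t sb hsb).toRingHom.comp
          (Algebra.TensorProduct.includeRight (R := A) (A := Ah)).toRingHom
      let f₂ : Localization.Away t →+* Localization.Away sb :=
        ((locTensorQuotEquiv I K hK t sb hsb).toRingHom.comp
          (IsLocalization.Away.tensorProductEquivTMulRight A Ah t (Localization.Away t)).toRingHom).comp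
          (Algebra.TensorProduct.includeRight (R := A) (A := Ah)).toRingHom
      suffices h : f₁ = f₂ from congrArg (fun f : Localization.Away t →+* Localization.Away sb => f z) h
      refine IsLocalization.ringHom_ext (Submonoid.powers t) (RingHom.ext fun b => ?_)
      change locChartMap I K hK t sb hsb (1 ⊗ₜ algebraMap (A ⧸ I) (Localization.Away t) b) =
        locTensorQuotEquiv I K hK t sb hsb
          (IsLocalization.Away.tensorProductEquivTMulRight A Ah t (Localization.Away t)
            (1 ⊗ₜ algebraMap (A ⧸ I) (Localization.Away t) b))
      rw [locChartMap_tmul, map_one, one_mul, locMap_algebraMap,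
        IsLocalization.Away.tensorProductEquivTMulRight_tmul, locTensorQuotEquiv,
        IsLocalization.ringEquivOfRingEquiv_eq]
      change _ = algebraMap (Ah ⧸ K) (Localization.Away sb) (tensorQuotEquiv I K hK (1 ⊗ₜ[A] b))
      rw [tensorQuotEquiv_one_tmul]
    have hmul : (y ⊗ₜ[A] z : Ah ⊗[A] Localization.Away t) = (y ⊗ₜ 1) * (1 ⊗ₜ z) := by
      rw [Algebra.TensorProduct.tmul_mul_tmul, mul_one, one_mul]
    rw [hmul, map_mul, map_mul, map_mul, hy, hz]
  | add z₁ z₂ h₁ h₂ => rw [map_add, h₁, h₂, map_add, map_add]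

/-- `Θ̃` is bijective. [folklore] -/
theorem locChartMap_bijective : Function.Bijective (locChartMap I K hK t sb hsb) := by
  have : (locChartMap I K hK t sb hsb : Ah ⊗[A] Localization.Away t → Localization.Away sb) =
      locTensorQuotEquiv I K hK t sb hsb ∘
        IsLocalization.Away.tensorProductEquivTMulRight A Ah t (Localization.Away t) :=
    funext (locChartMap_eq I K hK t sb hsb)
  rw [this]
  exact (locTensorQuotEquiv I K hK t sb hsb).bijective.comp (AlgEquiv.bijective _)

/-- **`Θ` is injective when `Ah` is flat over `A`** (`Ah ⊗ incl` is injective, `Θ̃` bijective).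
[folklore] -/
theorem chartMap_injective [Module.Flat A Ah] : Function.Injective (chartMap I K hK J t sb hsb) := by
  have hval : Function.Injective
      (LinearMap.lTensor Ah ((blowupAlgebra J t).val.restrictScalars A).toLinearMap) :=
    Module.Flat.lTensor_preserves_injective_linearMap _ Subtype.val_injective
  have heq : ∀ z, Algebra.TensorProduct.map (AlgHom.id Ah Ah) ((blowupAlgebra J t).val.restrictScalars A) z =
      LinearMap.lTensor Ah ((blowupAlgebra J t).val.restrictScalars A).toLinearMap z := by
    intro z
    induction z using TensorProduct.induction_on with
    | zero => rw [map_zero, map_zero]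
    | tmul y c => rw [Algebra.TensorProduct.map_tmul, LinearMap.lTensor_tmul]; rfl
    | add z₁ z₂ h₁ h₂ => rw [map_add, map_add, h₁, h₂]
  intro z₁ z₂ h
  rw [chartMap_eq_locChartMap_map, chartMap_eq_locChartMap_map, heq, heq] at h
  exact hval ((locChartMap_bijective I K hK t sb hsb).1 h)


/-! ### The range of `Θ` is the blowup algebra of `J·(Ah/K)` at `sb` -/

/-- `Θ (y ⊗ 1) = ȳ`. [folklore] -/
theorem chartMap_tmul_one (y : Ah) :
    chartMap I K hK J t sb hsb (y ⊗ₜ 1) = algebraMap (Ah ⧸ K) (Localization.Away sb) (Ideal.Quotient.mk K y) := by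
  rw [chartMap_tmul, OneMemClass.coe_one, map_one, mul_one, ← Ideal.Quotient.algebraMap_eq,
    ← IsScalarTower.algebraMap_apply]

/-- `Θ (1 ⊗ x/t) = q(x)/sb`. [folklore] -/
theorem chartMap_one_tmul_div {x : A ⧸ I} (hx : x ∈ J) :
    chartMap I K hK J t sb hsb (1 ⊗ₜ ⟨_, div_mem_blowupAlgebra J t hx⟩) =
      algebraMap (Ah ⧸ K) (Localization.Away sb) (quotBaseChange I K hK x) *
        IsLocalization.Away.invSelf sb := by
  rw [chartMap_tmul, map_one, one_mul, Subtype.coe_mk, map_mul, locMap_algebraMap, locMap_invSelf]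

/-- `ψ` maps the blowup algebra of `J` at `t` into that of `J·(Ah/K)` at `sb`. [folklore] -/
theorem locMap_mem_blowupAlgebra {z : Localization.Away t} (hz : z ∈ blowupAlgebra J t) :
    locMap I K hK t sb hsb z ∈ blowupAlgebra (J.map (quotBaseChange I K hK)) sb := by
  unfold blowupAlgebra at hz
  induction hz using Algebra.adjoin_induction with
  | mem z hz =>
    obtain ⟨x, hx, rfl⟩ := hz
    rw [map_mul, locMap_algebraMap, locMap_invSelf]
    exact div_mem_blowupAlgebra _ _ (Ideal.mem_map_of_mem _ hx)
  | algebraMap b =>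
    rw [locMap_algebraMap]
    exact Subalgebra.algebraMap_mem _ _
  | add z₁ z₂ _ _ h₁ h₂ =>
    rw [map_add]
    exact Subalgebra.add_mem _ h₁ h₂
  | mul z₁ z₂ _ _ h₁ h₂ =>
    rw [map_mul]
    exact Subalgebra.mul_mem _ h₁ h₂

/-- The range of `Θ` is contained in the blowup algebra of `J·(Ah/K)` at `sb`. [folklore] -/
theorem chartMap_mem_blowupAlgebra (z : Ah ⊗[A] ↥(blowupAlgebra J t)) :
    chartMap I K hK J t sb hsb z ∈ blowupAlgebra (J.map (quotBaseChange I K hK)) sb := by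
  induction z using TensorProduct.induction_on with
  | zero => rw [map_zero]; exact Subalgebra.zero_mem _
  | tmul y c =>
    rw [chartMap_tmul, IsScalarTower.algebraMap_apply Ah (Ah ⧸ K) (Localization.Away sb)]
    exact Subalgebra.mul_mem _ (Subalgebra.algebraMap_mem _ _)
      (locMap_mem_blowupAlgebra I K hK J t sb hsb c.2)
  | add z₁ z₂ h₁ h₂ => rw [map_add]; exact Subalgebra.add_mem _ h₁ h₂

/-- The range of `Θ` as an `Ah/K`-subalgebra of `(Ah/K)[1/sb]` (it contains `Ah/K`). [folklore] -/
def chartRange : Subalgebra (Ah ⧸ K) (Localization.Away sb) where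
  __ := (chartMap I K hK J t sb hsb).range.toSubsemiring
  algebraMap_mem' β := by
    obtain ⟨y, rfl⟩ := Ideal.Quotient.mk_surjective β
    change _ ∈ (chartMap I K hK J t sb hsb).range
    exact ⟨y ⊗ₜ 1, chartMap_tmul_one I K hK J t sb hsb y⟩

/-- Membership in `chartRange` is membership in the range. [folklore] -/
theorem mem_chartRange_iff {z : Localization.Away sb} :
    z ∈ chartRange I K hK J t sb hsb ↔ z ∈ (chartMap I K hK J t sb hsb).range := Iff.rfl

/-- The blowup algebra of `J·(Ah/K)` at `sb` is contained in the range of `Θ`: its generators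
`w/sb`, `w = Σ β_k q(x_k) ∈ J·(Ah/K)`, are `Σ β_k Θ(1 ⊗ x_k/t)`. [folklore] -/
theorem blowupAlgebra_le_chartRange :
    blowupAlgebra (J.map (quotBaseChange I K hK)) sb ≤ chartRange I K hK J t sb hsb := by
  unfold blowupAlgebra
  rw [Algebra.adjoin_le_iff]
  rintro _ ⟨w, hw, rfl⟩
  rw [SetLike.mem_coe, mem_chartRange_iff]
  -- induction on `w ∈ J·(Ah/K) = span (q '' J)`
  rw [Ideal.map] at hw
  induction hw using Submodule.span_induction with
  | mem w hw =>
    obtain ⟨x, hx, rfl⟩ := hw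
    exact ⟨_, chartMap_one_tmul_div I K hK J t sb hsb hx⟩
  | zero => exact ⟨0, by rw [map_zero, map_zero, zero_mul]⟩
  | add w₁ w₂ _ _ h₁ h₂ =>
    obtain ⟨z₁, hz₁⟩ := h₁
    obtain ⟨z₂, hz₂⟩ := h₂
    exact ⟨z₁ + z₂, by rw [map_add, hz₁, hz₂, map_add, add_mul]⟩
  | smul β w _ h =>
    obtain ⟨z, hz⟩ := h
    obtain ⟨y, rfl⟩ := Ideal.Quotient.mk_surjective β
    refine ⟨(y ⊗ₜ 1) * z, ?_⟩
    rw [map_mul, hz]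
    change chartMap I K hK J t sb hsb (y ⊗ₜ 1) * _ = _
    rw [chartMap_tmul_one, smul_eq_mul, map_mul, mul_assoc]

/-- **The range of `Θ` is the blowup algebra of `J·(Ah/K)` at `sb`.** [folklore] -/
theorem range_chartMap :
    (chartMap I K hK J t sb hsb).range =
      (blowupAlgebra (J.map (quotBaseChange I K hK)) sb).restrictScalars Ah := by
  apply le_antisymm
  · rintro _ ⟨z, rfl⟩
    exact chartMap_mem_blowupAlgebra I K hK J t sb hsb z
  · intro z hz
    rw [Subalgebra.mem_restrictScalars] at hz
    exact (mem_chartRange_iff I K hK J t sb hsb).mp (blowupAlgebra_le_chartRange I K hK J t sb hsb hz)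

/-- **The double-locus chart commutes with flat base change**: for `A → Ah` flat, `K = I·Ah`,
`J ⊆ A/I`, `t ∈ A/I` and `sb = q(t) ∈ Ah/K`,
`Ah ⊗_A (A/I)[J/t] ≅ (Ah/K)[J·(Ah/K)/sb]` as `Ah`-algebras (affine blowup algebras,
`AffineBlowupAlgebra.lean`; Stacks 0805: blowing up commutes with flat base change).
[cite: StacksProject, Tag 0805] -/
def chartBaseChangeEquiv [Module.Flat A Ah] :
    Ah ⊗[A] ↥(blowupAlgebra J t) ≃ₐ[Ah]
      ↥((blowupAlgebra (J.map (quotBaseChange I K hK)) sb).restrictScalars Ah) :=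
  (AlgEquiv.ofInjective _ (chartMap_injective I K hK J t sb hsb)).trans
    (Subalgebra.equivOfEq _ _ (range_chartMap I K hK J t sb hsb))

/-- Unfolding `chartBaseChangeEquiv`. [folklore] -/
theorem chartBaseChangeEquiv_apply [Module.Flat A Ah] (z : Ah ⊗[A] ↥(blowupAlgebra J t)) :
    (chartBaseChangeEquiv I K hK J t sb hsb z : Localization.Away sb) = chartMap I K hK J t sb hsb z :=
  rfl

end BaseChange

/-! ## The chart of the double locus and its formal branch decomposition -/

section Chart

variable {A : Type u} [CommRing A] (I : Ideal A)
variable {P : Type u} [CommRing P] [Algebra A P] [IsRegularLocalRing P]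
variable {d : ℕ} (x : Fin d → P) (r : ℕ) (hx : ∀ i, x i ∈ maximalIdeal P)
  (hli : LinearIndependent (ResidueField P) fun i => (maximalIdeal P).toCotangent ⟨x i, hx i⟩)
  (a : Fin d → P) (ha : ∀ j ∈ branchSet d r, IsUnit (a j))
variable (hI : I.map (algebraMap A P) = Ideal.span {branchProd x r})
variable (𝔇 : Ideal A) (s : A)
  (h𝔇 : (𝔇.map (algebraMap A P)).map (Ideal.Quotient.mk (Ideal.span {branchProd x r})) =
    (doubleLocusIdeal x r).map (Ideal.Quotient.mk _))
  (hs : Ideal.Quotient.mk (Ideal.span {branchProd x r}) (algebraMap A P s) =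
    Ideal.Quotient.mk _ (cofactorSum x r a))

/-- **The chart of the double locus**: the affine blowup algebra `C = (A/I)[𝔇̄/s̄]` of the
(image of the) ideal `𝔇` of the double locus at the generic element `s`, a subalgebra of
`(A/I)[1/s̄]`. [cite: DeJong1996, 4.25 (i), p. 75] -/
abbrev doubleLocusChart : Subalgebra (A ⧸ I) (Localization.Away (Ideal.Quotient.mk I s)) :=
  blowupAlgebra (𝔇.map (Ideal.Quotient.mk I)) (Ideal.Quotient.mk I s)

omit [IsRegularLocalRing P] in
include hs in
/-- The image of `s̄` in `P/(π)` is the generic generator `s̄ = Σ a_j m_j`. [folklore] -/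
theorem quotBaseChange_mk_s :
    quotBaseChange I (Ideal.span {branchProd x r}) hI (Ideal.Quotient.mk I s) =
      Ideal.Quotient.mk _ (cofactorSum x r a) := by
  rw [quotBaseChange_mk, hs]

omit [IsRegularLocalRing P] in
include h𝔇 in
/-- The image of `𝔇̄` in `P/(π)` is the ideal of the double locus. [folklore] -/
theorem map_map_doubleLocus :
    (𝔇.map (Ideal.Quotient.mk I)).map (quotBaseChange I (Ideal.span {branchProd x r}) hI) =
      (doubleLocusIdeal x r).map (Ideal.Quotient.mk _) := by
  rw [Ideal.map_map, ← h𝔇, Ideal.map_map]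
  congr 1

/-- **The formal branch decomposition of the chart**: for `A → P` flat into a regular local
ring `P` with `x₁, …, x_d ∈ 𝔪_P` linearly independent modulo `𝔪_P²`, `I·P = (x₁ ⋯ x_r)`,
`𝔇·P ≡ (m_j)_j` and `s ≡ Σ_j a_j m_j` modulo `(x₁ ⋯ x_r)` (`a_j` units),
`P ⊗_A (A/I)[𝔇̄/s̄] ≅ Π_{j<r} P/(xⱼ)` as `P`-algebras: the chart commutes with the flat base
change (`chartBaseChangeEquiv`) and the chart of the formal model is the product of the branch
rings (`branchModelEquiv`, `FormalBranchesModel.lean`). [cite: DeJong1996, 4.25 (i), p. 75] -/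
def doubleLocusChartEquiv [Module.Flat A P] :
    P ⊗[A] ↥(doubleLocusChart I 𝔇 s) ≃ₐ[P] BranchProduct x r :=
  (chartBaseChangeEquiv I (Ideal.span {branchProd x r}) hI (𝔇.map (Ideal.Quotient.mk I))
      (Ideal.Quotient.mk I s) (Ideal.Quotient.mk _ (cofactorSum x r a))
      (quotBaseChange_mk_s I x r a hI s hs)).trans
    ((Subalgebra.equivOfEq _ _ (by rw [map_map_doubleLocus I x r hI 𝔇 h𝔇])).trans
      (branchModelEquiv x r a ha hx hli).symm)

include hx hli ha hI h𝔇 hs in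
/-- **The chart is a finite `A`-algebra** when `A → P` is faithfully flat (descent of finiteness
from `P ⊗_A C ≅ Π_{j<r} P/(xⱼ)`, Mathlib `Module.Finite.of_finite_tensorProduct_of_faithfullyFlat`).
[folklore] -/
theorem finite_doubleLocusChart [Module.FaithfullyFlat A P] :
    Module.Finite A ↥(doubleLocusChart I 𝔇 s) := by
  haveI : Module.Finite P (P ⊗[A] ↥(doubleLocusChart I 𝔇 s)) :=
    Module.Finite.equiv (doubleLocusChartEquiv I x r hx hli a ha hI 𝔇 s h𝔇 hs).symm.toLinearEquiv
  exact Module.Finite.of_finite_tensorProduct_of_faithfullyFlat P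

end Chart

end Literature.AlgebraicGeometry.Resolution

end
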